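import Mathlib
import Summits.Ventures.HodgeRepro.Tier3Weierstrass
import Summits.Ventures.HodgeRepro.Tier3RootsOfUnityEval
import Summits.Ventures.HodgeRepro.Tier3PadicComplexInt

/-!
# Tier4/Line2/TorsionEval — the kernel lemmas K1b and K1c of LINE L2 in generic form
(seat t4-L2-p2, gen 0; blind re-derivation cell `pub-hodge-repro`, Tier 4, README §9–§10)

LINE L2 (t4-plan-2, `Tier4/Line2/Skeleton.lean` v0.8) closes its torsion-point density
`exists_torsionPt_aeval_ne_zero` from three Mathlib-level stubs K1a–K1c.  This file proves K1b and K1c over the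
BARE instance bundle of the skeleton's `BranchCoefficients` (`p` prime; `A` a complete DVR with a uniform ring
structure and a continuous algebra map `A → 𝓞_ℂ_[p]`); the statements VERBATIM from the skeleton, over
`O : BranchCoefficients`, are the one-line instantiations in `Tier4/Line2/K1b.lean` and `Tier4/Line2/K1c.lean`.

* K1b `exists_torsion_aeval_ne_zero_one_generic` — ONE VARIABLE: a non-zero `G ∈ A⟦X⟧` is non-zero at some
  `ζ − 1`, `ζ ∈ 𝓞_ℂ_[p]` a `p`-power root of unity.  The landed Weierstrass item
  `PowerSeries.finite_rootsOfUnity_zeros_of_ne_zero` (Tier3Weierstrass) says only FINITELY many such `ζ` are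
  zeros of `G`; `infinite_setOf_pow_prime_pow_eq_one` says there are INFINITELY many `p`-power roots of unity in
  `𝓞_ℂ_[p]` (`ℂ_[p]` is algebraically closed of characteristic `0`: a primitive `p^n`-th root of unity for every
  `n`, pairwise distinct by their orders, of norm `1`); `ζ − 1` is an evaluation point by the landed
  `hasEval_sub_one_of_pow_prime_pow_eq_one` (Tier3RootsOfUnityEval) on `𝓞_ℂ_[p]` (Tier3PadicComplexInt).
* K1c `aeval_subst_frobenius_generic` — COMPATIBILITY: evaluating `F ∈ A⟦T_1, …, T_d⟧` at the Frobenius-line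
  point `(ζ^{p^{k_i}} − 1)_i` is evaluating its one-variable restriction `F((1+X)^{p^{k_1}} − 1, …)` at `ζ − 1`.
  Mathlib's `MvPowerSeries.eval₂_subst` (substitution is evaluation) is stated for the DISCRETE uniformity on the
  coefficient ring; `eval₂_eq_eval₂_bot` transports it to the ambient one (both evaluations are the same sum
  `∑' d, φ (coeff d f) * a^d` in `𝓞_ℂ_[p]`, `MvPowerSeries.eval₂_eq_tsum`), and `eval₂_one_add_X_pow_sub_one`
  computes the inner values `X ↦ ζ − 1 : (1+X)^{p^k} − 1 ↦ ζ^{p^k} − 1`.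

HONESTY.  Commutative algebra on Mathlib plus three landed Tier-3 modules; nothing here is about Hecke characters,
Katz measures or `L`-values — the identification of `F` with a measure and of its values with `L`-values is the
line's (printed) interpolation input, not this file's.  Nothing here says anything about the status of the Hodge
conjecture for CM abelian varieties, which is NOT proved (HC_CM is NOT proved by anyone in this repository).
-/

set_option autoImplicit false

noncomputable section

namespace Summit.Ventures.HodgeRepro.Tier4.Line2

/-! ## K1b — one variable: infinitely many `p`-power roots of unity, finitely many zeros -/

open Summit.Ventures.HodgeRepro.T3.R2Pinning

variable (p : ℕ) [Fact p.Prime]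

/-- A `p^n`-th root of unity of `ℂ_[p]` has norm `1`, hence lies in `𝓞_ℂ_[p]`. -/
theorem mem_padicComplexInt_of_pow_eq_one {ζ : ℂ_[p]} {m : ℕ} (hm : m ≠ 0) (hζ : ζ ^ m = 1) :
    ζ ∈ 𝓞_ℂ_[p] := by
  rw [mem_padicComplexInt_iff]
  have h : ‖ζ‖ ^ m = 1 := by rw [← norm_pow, hζ, norm_one]
  exact ((pow_eq_one_iff_of_nonneg (norm_nonneg ζ) hm).mp h).le

/-- **Infinitely many `p`-power roots of unity in `𝓞_ℂ_[p]`**: `ℂ_[p]` is algebraically closed of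
characteristic `0`, so it has a primitive `p^n`-th root of unity `ζ_n` for every `n`; the `ζ_n` are pairwise
distinct (their orders differ) and lie in the unit ball. -/
theorem infinite_setOf_pow_prime_pow_eq_one :
    {ζ : 𝓞_ℂ_[p] | ∃ n : ℕ, ζ ^ p ^ n = 1}.Infinite := by
  have hp : p.Prime := Fact.out
  haveI : NeZero p := ⟨hp.ne_zero⟩
  have hprim : ∀ n : ℕ, ∃ ζ : ℂ_[p], IsPrimitiveRoot ζ (p ^ n) := fun n =>
    HasEnoughRootsOfUnity.exists_primitiveRoot ℂ_[p] (p ^ n)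
  choose ζ hζ using hprim
  have hmem : ∀ n, ζ n ∈ 𝓞_ℂ_[p] := fun n =>
    mem_padicComplexInt_of_pow_eq_one p (pow_ne_zero n hp.ne_zero) (hζ n).pow_eq_one
  let f : ℕ → 𝓞_ℂ_[p] := fun n => ⟨ζ n, hmem n⟩
  have hinj : Function.Injective f := by
    intro n m hnm
    have h1 : ζ n = ζ m := congrArg Subtype.val hnm
    have h2 : p ^ n = p ^ m := by
      rw [(hζ n).eq_orderOf, (hζ m).eq_orderOf, h1]
    exact Nat.pow_right_injective hp.two_le h2
  refine Set.infinite_of_injective_forall_mem hinj fun n => ⟨n, ?_⟩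
  apply Subtype.ext
  simp only [f, SubmonoidClass.coe_pow, OneMemClass.coe_one]
  exact (hζ n).pow_eq_one

/-- `ζ − 1` is an evaluation point of `𝓞_ℂ_[p]` for every `p`-power root of unity `ζ`
(the landed `hasEval_sub_one_of_pow_prime_pow_eq_one` on `B := 𝓞_ℂ_[p]`). -/
theorem hasEval_sub_one_of_torsion {ζ : 𝓞_ℂ_[p]} (hζ : ∃ n : ℕ, ζ ^ p ^ n = 1) :
    PowerSeries.HasEval (ζ - 1) := by
  obtain ⟨n, hn⟩ := hζ
  exact hasEval_sub_one_of_pow_prime_pow_eq_one (Fact.out : p.Prime)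
    (isTopologicallyNilpotent_natCast_prime p) hn

variable {p}

/-- K1b, GENERIC FORM (bare instance bundle): a non-zero `G ∈ A⟦X⟧` over a complete DVR `A ↪ 𝓞_ℂ_[p]` is
non-zero at some `ζ − 1`, `ζ ∈ 𝓞_ℂ_[p]` a `p`-power root of unity — the landed Weierstrass finiteness
(`PowerSeries.finite_rootsOfUnity_zeros_of_ne_zero`: only finitely many such `ζ` are zeros) against the
infinitude of the `p`-power roots of unity. -/
theorem exists_torsion_aeval_ne_zero_one_generic {A : Type*} [CommRing A] [IsDomain A]
    [IsDiscreteValuationRing A] [IsAdicComplete (IsLocalRing.maximalIdeal A) A] [UniformSpace A]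
    [IsUniformAddGroup A] [IsTopologicalRing A] [Algebra A 𝓞_ℂ_[p]] [ContinuousSMul A 𝓞_ℂ_[p]]
    (hinj : Function.Injective (algebraMap A 𝓞_ℂ_[p])) (G : PowerSeries A) (hG : G ≠ 0) :
    ∃ ζ : 𝓞_ℂ_[p], (∃ n : ℕ, ζ ^ p ^ n = 1) ∧
      ∃ hζ : PowerSeries.HasEval (ζ - 1), PowerSeries.aeval hζ G ≠ 0 := by
  have hfin := PowerSeries.finite_rootsOfUnity_zeros_of_ne_zero (B := 𝓞_ℂ_[p]) hinj hG
  obtain ⟨ζ, hζT, hζZ⟩ := ((infinite_setOf_pow_prime_pow_eq_one p).sdiff hfin).nonempty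
  refine ⟨ζ, hζT, hasEval_sub_one_of_torsion p hζT, fun h0 => hζZ ?_⟩
  exact ⟨hasEval_sub_one_of_torsion p hζT, h0⟩


/-! ## K1c — substitution along the Frobenius lines is evaluation -/

open MvPowerSeries in
/-- **Evaluation does not see the topology of the coefficient ring**: for `φ` continuous for BOTH a uniform
structure `u` on `R` and the discrete one, and `a` an evaluation point, `eval₂ φ a f` computed with `u`
equals `eval₂ φ a f` computed with the discrete uniformity — both are the sum `∑' d, φ (coeff d f) * a^d`
in `S` (`MvPowerSeries.eval₂_eq_tsum`), which never mentions the topology of `R`. -/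
theorem eval₂_eq_eval₂_bot {σ R S : Type*} [CommRing R] [UniformSpace R] [IsTopologicalSemiring R]
    [IsUniformAddGroup R] [CommRing S] [UniformSpace S] [IsUniformAddGroup S] [CompleteSpace S] [T2Space S]
    [IsTopologicalRing S] [IsLinearTopology S S] {φ : R →+* S} (hφ : Continuous φ) {a : σ → S}
    (ha : MvPowerSeries.HasEval a) (f : MvPowerSeries σ R) :
    MvPowerSeries.eval₂ φ a f = @MvPowerSeries.eval₂ σ R _ ⊥ S _ _ φ a f := by
  have key : @MvPowerSeries.eval₂ σ R _ ⊥ S _ _ φ a f =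
      ∑' d : σ →₀ ℕ, φ (coeff d f) * d.prod fun s e => a s ^ e := by
    letI : UniformSpace R := ⊥
    exact MvPowerSeries.eval₂_eq_tsum continuous_of_discreteTopology ha f
  rw [key, MvPowerSeries.eval₂_eq_tsum hφ ha f]

/-- The value of `(1 + X)^n − 1` at a topologically nilpotent point `x` is `(1 + x)^n − 1`
(the evaluation is a ring homomorphism). -/
theorem eval₂_one_add_X_pow_sub_one {R S : Type*} [CommRing R] [UniformSpace R] [IsTopologicalSemiring R]
    [IsUniformAddGroup R] [CommRing S] [UniformSpace S] [IsUniformAddGroup S] [CompleteSpace S] [T2Space S]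
    [IsTopologicalRing S] [IsLinearTopology S S] {φ : R →+* S} (hφ : Continuous φ) {x : S}
    (hx : PowerSeries.HasEval x) (n : ℕ) :
    PowerSeries.eval₂ φ x ((1 + PowerSeries.X) ^ n - 1) = (1 + x) ^ n - 1 := by
  rw [← PowerSeries.coe_eval₂Hom hφ hx, map_sub, map_pow, map_add, map_one, PowerSeries.coe_eval₂Hom hφ hx,
    PowerSeries.eval₂_X]

/-- K1c, GENERIC FORM (bare instance bundle): evaluating `F ∈ A⟦T_1, …, T_d⟧` at the Frobenius-line point
`(ζ^{p^{k_i}} − 1)_i` is evaluating its one-variable restriction `F((1+X)^{p^{k_1}} − 1, …)` at `ζ − 1`.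
Proof: `MvPowerSeries.eval₂_subst` (substitution is evaluation, stated by Mathlib for the DISCRETE uniformity on
the coefficients) transported to the ambient uniformity by `eval₂_eq_eval₂_bot`, and `X ↦ ζ − 1` sends
`(1+X)^{p^k} − 1` to `ζ^{p^k} − 1`. -/
theorem aeval_subst_frobenius_generic {p : ℕ} [Fact p.Prime] {A : Type*} [CommRing A]
    [UniformSpace A] [IsUniformAddGroup A] [IsTopologicalRing A]
    [Algebra A 𝓞_ℂ_[p]] [ContinuousSMul A 𝓞_ℂ_[p]] {d : ℕ} (F : MvPowerSeries (Fin d) A) (k : Fin d → ℕ)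
    (ζ : 𝓞_ℂ_[p]) (hζ : PowerSeries.HasEval (ζ - 1))
    (hη : MvPowerSeries.HasEval (fun i : Fin d => ζ ^ p ^ k i - 1)) :
    MvPowerSeries.aeval hη F =
      PowerSeries.aeval hζ
        (MvPowerSeries.subst (fun i : Fin d => (1 + PowerSeries.X) ^ p ^ k i - 1 : Fin d → PowerSeries A) F) := by
  set a : Fin d → PowerSeries A := fun i => (1 + PowerSeries.X) ^ p ^ k i - 1
  have hsub : MvPowerSeries.HasSubst a := by
    refine MvPowerSeries.hasSubst_of_constantCoeff_zero fun i => ?_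
    have hX : MvPowerSeries.constantCoeff (PowerSeries.X : PowerSeries A) = 0 := MvPowerSeries.constantCoeff_X ()
    simp [a, hX]
  have hb : MvPowerSeries.HasEval (fun _ : Unit => ζ - 1) := PowerSeries.hasEval hζ
  have hφ : Continuous (algebraMap A 𝓞_ℂ_[p]) := continuous_algebraMap A 𝓞_ℂ_[p]
  -- the substitution identity, in the discrete world
  have hsubst : @MvPowerSeries.eval₂ Unit A _ ⊥ 𝓞_ℂ_[p] _ _ (algebraMap A 𝓞_ℂ_[p]) (fun _ => ζ - 1)
        (MvPowerSeries.subst a F) =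
      @MvPowerSeries.eval₂ (Fin d) A _ ⊥ 𝓞_ℂ_[p] _ _ (algebraMap A 𝓞_ℂ_[p])
        (fun i => @MvPowerSeries.eval₂ Unit A _ ⊥ 𝓞_ℂ_[p] _ _ (algebraMap A 𝓞_ℂ_[p]) (fun _ => ζ - 1) (a i)) F := by
    letI : UniformSpace A := ⊥
    exact MvPowerSeries.eval₂_subst hsub hb F
  -- the inner evaluations are the Frobenius-line point
  have hinner : (fun i => @MvPowerSeries.eval₂ Unit A _ ⊥ 𝓞_ℂ_[p] _ _ (algebraMap A 𝓞_ℂ_[p])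
      (fun _ => ζ - 1) (a i)) = fun i : Fin d => ζ ^ p ^ k i - 1 := by
    funext i
    letI : UniformSpace A := ⊥
    have := eval₂_one_add_X_pow_sub_one (φ := algebraMap A 𝓞_ℂ_[p]) continuous_of_discreteTopology hζ (p ^ k i)
    rw [show (1 : 𝓞_ℂ_[p]) + (ζ - 1) = ζ by ring] at this
    exact this
  rw [hinner] at hsubst
  rw [MvPowerSeries.coe_aeval, PowerSeries.coe_aeval, PowerSeries.eval₂,
    eval₂_eq_eval₂_bot hφ hη F, eval₂_eq_eval₂_bot hφ hb (MvPowerSeries.subst a F), hsubst]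


end Summit.Ventures.HodgeRepro.Tier4.Line2
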